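import Summits.Parity.GeneralizedHardyLittlewood.Theorems.GreenTaoLevelTwoMNTwoTypeIIXformInt
import Summits.Parity.GeneralizedHardyLittlewood.Theorems.GreenTaoLevelTwoMNTwoTypeIIBasePoint
import Summits.Parity.GeneralizedHardyLittlewood.Theorems.GreenTaoLevelTwoMNTwoProgressionReindex
import Summits.Parity.GeneralizedHardyLittlewood.Theorems.GreenTaoLevelTwoMNTwoTypeIISixteenfold
import Summits.Parity.GeneralizedHardyLittlewood.Theorems.GreenTaoLevelTwoMNTwoSixteenSum
import Summits.Parity.GeneralizedHardyLittlewood.Theorems.GreenTaoLevelTwoMNTwoBohrGauge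

/-!
# Route `GreenTaoLevelTwo`, crux `MNTwo` (stmt-Parity-21276), line `birth`, stub `stub_mnVertical`:
# Lemma 24, first half composed: type II alternative ⇒ large sixteenfold cutoff–phase sum

Composition of steps 1–5 of the remaining Lemma-24 assembly for `stub_mnVertical` (B. Green,
T. Tao, *Quadratic uniformity of the Möbius function*, Ann. Inst. Fourier 58 (2008) =
arXiv:math/0606087, §10, proof of Lemma 24 up to (llm)).  Def-free: from the type II alternative
of the dichotomy (exactly as in the hypothesis `hL` of `…MNTwoTypeIIHalf.typeII_half`) at level
`η` with `ηW ≥ 2` (`W = ⌊2N/K⌋`), shifts `s, t` and lengths `L, M` with `L|s| ≤ K/2`,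
`M|t| ≤ W/2` and `L·M·ν(st) ≤ ρ`, there are a base point `(d, w)`, a centre `(l₀, m₀)`, a lift `θ`
of `φ''(st,st)` and the cutoff `wt(l,m) = 1_{[1,L]×[1,M]}(l,m)·ψ((d+sl)(w+tm))` such that
`Y₁₆ ≤ Re ∑_{l₁,m₁,l₂,m₂} (Π₁₆ wt)·e(2θ l₁l₂m₁m₂)` with
`Y₁₆ = ((η²LM/8)⁴/(L²M²))⁴/((2L+1)³(2M+1)³L³M³)`.  Chain: `typeII_Xform_int` → `typeII_base_point`
→ `progression_sum_eq` → `typeII_sixteenfold` → `sixteen_sum_eq`.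

* `typeII_large_sixteen` — the statement just described.

References: [GreenTao2008QuadraticMobius] arXiv:math/0606087 §10 (proof of Lemma 24).
-/

noncomputable section

open Finset
open scoped ComplexConjugate FourierTransform

namespace Summit.Parity.GeneralizedHardyLittlewood.GreenTaoLevelTwoMNTwoTypeIILargeSixteen

open Summit.Parity.GeneralizedHardyLittlewood.GreenTaoLevelTwoMNTwoTypeIIXformInt (typeII_Xform_int)
open Summit.Parity.GeneralizedHardyLittlewood.GreenTaoLevelTwoMNTwoTypeIIBasePoint (typeII_base_point)
open Summit.Parity.GeneralizedHardyLittlewood.GreenTaoLevelTwoMNTwoProgressionReindex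
  (progression_sum_eq cutoff_vanish)
open Summit.Parity.GeneralizedHardyLittlewood.GreenTaoLevelTwoMNTwoTypeIISixteenfold
  (typeII_sixteenfold)
open Summit.Parity.GeneralizedHardyLittlewood.GreenTaoLevelTwoMNTwoSixteenSum (sixteen_sum_eq)
open Summit.Parity.GeneralizedHardyLittlewood.GreenTaoLevelTwoMNTwoBohrGauge
  (bohrGauge_nonneg bohrGauge_zero bohrGauge_neg bohrGauge_add_le)

/-- **Lemma 24, first half (GT 2008b §10 up to (llm)).**  See the module docstring.
[cite: GreenTao2008QuadraticMobius, §10 (proof of Lemma 24)] -/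
theorem typeII_large_sixteen (k : ℕ) {N : ℕ} (α : Fin k → ℝ) (n₀ : ℤ) {ρ : ℝ}
    (hρ : 0 < ρ) (φ : ℤ → UnitAddCircle) :
        (∀ n a b c : ℤ,
          (⨆ i : Fin k, ‖((((n - n₀ : ℤ) : ℝ) * α i : ℝ) : AddCircle (1 : ℝ))‖) +
              |((n - n₀ : ℤ) : ℝ)| / N < 100 * ρ →
          (⨆ i : Fin k, ‖((((n + a - n₀ : ℤ) : ℝ) * α i : ℝ) : AddCircle (1 : ℝ))‖) +
              |((n + a - n₀ : ℤ) : ℝ)| / N < 100 * ρ →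
          (⨆ i : Fin k, ‖((((n + b - n₀ : ℤ) : ℝ) * α i : ℝ) : AddCircle (1 : ℝ))‖) +
              |((n + b - n₀ : ℤ) : ℝ)| / N < 100 * ρ →
          (⨆ i : Fin k, ‖((((n + c - n₀ : ℤ) : ℝ) * α i : ℝ) : AddCircle (1 : ℝ))‖) +
              |((n + c - n₀ : ℤ) : ℝ)| / N < 100 * ρ →
          (⨆ i : Fin k, ‖((((n + a + b - n₀ : ℤ) : ℝ) * α i : ℝ) : AddCircle (1 : ℝ))‖) +
              |((n + a + b - n₀ : ℤ) : ℝ)| / N < 100 * ρ →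
          (⨆ i : Fin k, ‖((((n + a + c - n₀ : ℤ) : ℝ) * α i : ℝ) : AddCircle (1 : ℝ))‖) +
              |((n + a + c - n₀ : ℤ) : ℝ)| / N < 100 * ρ →
          (⨆ i : Fin k, ‖((((n + b + c - n₀ : ℤ) : ℝ) * α i : ℝ) : AddCircle (1 : ℝ))‖) +
              |((n + b + c - n₀ : ℤ) : ℝ)| / N < 100 * ρ →
          (⨆ i : Fin k, ‖((((n + a + b + c - n₀ : ℤ) : ℝ) * α i : ℝ) : AddCircle (1 : ℝ))‖) +
              |((n + a + b + c - n₀ : ℤ) : ℝ)| / N < 100 * ρ →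
          φ (n + a + b + c) - φ (n + a + b) - φ (n + a + c) - φ (n + b + c)
            + φ (n + a) + φ (n + b) + φ (n + c) - φ n = 0) →
    ∀ (ψ : ℤ → ℝ), (∀ n, 0 ≤ ψ n) → (∀ n, ψ n ≤ 1) →
      (∀ n, ψ n ≠ 0 →
        (⨆ i : Fin k, ‖((((n - n₀ : ℤ) : ℝ) * α i : ℝ) : AddCircle (1 : ℝ))‖) +
          |((n - n₀ : ℤ) : ℝ)| / N < ρ) →
      (∀ n, ψ n ≠ 0 → (N : ℤ) < n ∧ n ≤ 2 * N) →
    ∀ (η : ℝ), 0 < η → η ≤ 1 →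
    ∀ (K w' : ℕ), 1 ≤ K → w' ∈ Icc 1 (2 * N / K) → 2 ≤ η * ((2 * N / K : ℕ) : ℝ) →
      η * ((2 * N / K : ℕ) : ℝ) - 1 ≤ #((Icc 1 (2 * N / K)).filter fun w => w ≠ w' ∧
        η * K ≤ ‖∑ d ∈ Ioc K (min (2 * K) (min (2 * N / w) (2 * N / w'))),
          ((ψ ((d * w : ℕ) : ℤ) : ℝ) : ℂ) * (AddCircle.toCircle (φ ((d * w : ℕ) : ℤ)) : ℂ) *
            conj (((ψ ((d * w' : ℕ) : ℤ) : ℝ) : ℂ) *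
              (AddCircle.toCircle (φ ((d * w' : ℕ) : ℤ)) : ℂ))‖) →
    ∀ (s t : ℤ) (L M : ℕ), 1 ≤ L → 1 ≤ M →
      (L : ℝ) * |(s : ℝ)| ≤ (K : ℝ) / 2 → (M : ℝ) * |(t : ℝ)| ≤ ((2 * N / K : ℕ) : ℝ) / 2 →
      (L : ℝ) * (M : ℝ) *
          ((⨆ i : Fin k, ‖((((s * t : ℤ) : ℝ) * α i : ℝ) : AddCircle (1 : ℝ))‖) +
            |((s * t : ℤ) : ℝ)| / N) ≤ ρ →
    ∃ (d w l₀ m₀ : ℤ) (θ : ℝ) (wt : ℤ → ℤ → ℝ),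
      (∀ l m, wt l m = if l ∈ Icc (1 : ℤ) L ∧ m ∈ Icc (1 : ℤ) M
        then ψ ((d + s * l) * (w + t * m)) else 0) ∧
      ((θ : ℝ) : UnitAddCircle) =
        φ (n₀ + s * t + s * t) - φ (n₀ + s * t) - φ (n₀ + s * t) + φ n₀ ∧
      ((η ^ 2 * L * M / 8) ^ 4 / ((L : ℝ) ^ 2 * (M : ℝ) ^ 2)) ^ 4 /
          (((2 * L + 1 : ℕ) : ℝ) ^ 3 * ((2 * M + 1 : ℕ) : ℝ) ^ 3 * (L : ℝ) ^ 3 * (M : ℝ) ^ 3) ≤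
      (
    ∑ l₁ ∈ Icc (-(L : ℤ)) L, ∑ m₁ ∈ Icc (-(M : ℤ)) M, ∑ l₂ ∈ Icc (-(L : ℤ)) L,
      ∑ m₂ ∈ Icc (-(M : ℤ)) M,
      (((wt l₀ m₀ * wt l₀ (m₀ + m₁) * wt (l₀ + l₁) m₀ * wt (l₀ + l₁) (m₀ + m₁)) *
        (wt l₀ (m₀ + m₂) * wt l₀ (m₀ + m₂ + m₁) * wt (l₀ + l₁) (m₀ + m₂) *
          wt (l₀ + l₁) (m₀ + m₂ + m₁)) *
        (wt (l₀ + l₂) m₀ * wt (l₀ + l₂) (m₀ + m₁) * wt (l₀ + l₂ + l₁) m₀ *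
          wt (l₀ + l₂ + l₁) (m₀ + m₁)) *
        (wt (l₀ + l₂) (m₀ + m₂) * wt (l₀ + l₂) (m₀ + m₂ + m₁) * wt (l₀ + l₂ + l₁) (m₀ + m₂) *
          wt (l₀ + l₂ + l₁) (m₀ + m₂ + m₁)) : ℝ) : ℂ) *
      (𝐞 (2 * θ * l₁ * l₂ * m₁ * m₂) : ℂ)).re := by
  classical
  intro hφ ψ hψ0 hψ1 hsupp hsuppN η hη hη1 K w' hK hw' hηW hgood s t L M hL hM hs ht hst
  -- the gauge
  set ν : ℤ → ℝ := fun n => (⨆ i : Fin k, ‖(((n : ℝ) * α i : ℝ) : AddCircle (1 : ℝ))‖) +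
    |(n : ℝ)| / N with hν
  have hν0 : ν 0 = 0 := bohrGauge_zero α N
  have hνnn : ∀ x, 0 ≤ ν x := fun x => bohrGauge_nonneg α N x
  have hνneg : ∀ x, ν (-x) = ν x := fun x => bohrGauge_neg α N x
  have hνadd : ∀ x y, ν (x + y) ≤ ν x + ν y := fun x y => bohrGauge_add_le α N x y
  have hKr : (0 : ℝ) < K := by exact_mod_cast hK
  have hW1 : 1 ≤ 2 * N / K := by
    have h1 : η * ((2 * N / K : ℕ) : ℝ) ≤ 1 * ((2 * N / K : ℕ) : ℝ) :=
      mul_le_mul_of_nonneg_right hη1 (Nat.cast_nonneg _)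
    have h2 : (1 : ℝ) ≤ ((2 * N / K : ℕ) : ℝ) := by linarith
    exact_mod_cast h2
  have hWr : (0 : ℝ) < ((2 * N / K : ℕ) : ℝ) := by exact_mod_cast hW1
  -- step 1: the `ℤ`-indexed `X`-form
  obtain ⟨b₁, b₂, hb₁, hb₂, hGv, hX⟩ := typeII_Xform_int hK ψ φ hψ0 hψ1 hsuppN hη hw' hgood
  -- step 2: a base point
  obtain ⟨d, -, w, -, hbase⟩ := typeII_base_point
    (fun d w => b₂ w * b₁ d * (((ψ (d * w) : ℝ) : ℂ) * (AddCircle.toCircle (φ (d * w)) : ℂ)))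
    hK hW1 hGv hX s t hL hM (ε := 1 / 2) le_rfl (by linarith) (by linarith)
  have hZ : η ^ 2 * L * M / 8 ≤
      ‖∑ l ∈ Icc (1 : ℕ) L, ∑ m ∈ Icc (1 : ℕ) M,
        b₂ (w + t * (m : ℤ)) * b₁ (d + s * (l : ℤ)) *
          ((((ψ ((d + s * (l : ℤ)) * (w + t * (m : ℤ))) : ℝ)) : ℂ) *
            (AddCircle.toCircle (φ ((d + s * (l : ℤ)) * (w + t * (m : ℤ)))) : ℂ))‖ := by
    refine le_trans ?_ hbase
    have h1 : η * ((2 * N / K : ℕ) : ℝ) / 2 ≤ η * ((2 * N / K : ℕ) : ℝ) - 1 := by linarith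
    have h2 : η * ((2 * N / K : ℕ) : ℝ) / 2 * (η * K) ≤
        (η * ((2 * N / K : ℕ) : ℝ) - 1) * (η * K) :=
      mul_le_mul_of_nonneg_right h1 (by positivity)
    have h3 : η * ((2 * N / K : ℕ) : ℝ) / 2 * (η * K) * L * M ≤
        (η * ((2 * N / K : ℕ) : ℝ) - 1) * (η * K) * L * M :=
      mul_le_mul_of_nonneg_right (mul_le_mul_of_nonneg_right h2 (Nat.cast_nonneg _))
        (Nat.cast_nonneg _)
    calc η ^ 2 * L * M / 8
        = η * ((2 * N / K : ℕ) : ℝ) / 2 * (η * K) * L * M / (4 * K * ((2 * N / K : ℕ) : ℝ)) := by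
          field_simp
          ring
      _ ≤ (η * ((2 * N / K : ℕ) : ℝ) - 1) * (η * K) * L * M / (4 * K * ((2 * N / K : ℕ) : ℝ)) :=
          div_le_div_of_nonneg_right h3 (by positivity)
  -- step 2→3: the cutoff form
  rw [progression_sum_eq b₁ b₂ ψ φ d w s t L M] at hZ
  -- steps 3–4: two Cauchy–Schwarz steps and the pigeonhole
  obtain ⟨l₀, -, m₀, -, h16⟩ := typeII_sixteenfold hL hM
    (fun l m => ((((if l ∈ Icc (1 : ℤ) L ∧ m ∈ Icc (1 : ℤ) M then ψ ((d + s * l) * (w + t * m))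
      else 0 : ℝ)) : ℂ) * (AddCircle.toCircle (φ ((d + s * l) * (w + t * m))) : ℂ)))
    (cutoff_vanish ψ φ d w s t L M) (fun l => b₁ (d + s * l)) (fun m => b₂ (w + t * m))
    (fun l => hb₁ _) (fun m => hb₂ _) (Z := η ^ 2 * L * M / 8) (by positivity) hZ
  -- step 5: the sixteen phases combine
  obtain ⟨θ, hθ⟩ := QuotientAddGroup.mk_surjective
    (φ (n₀ + s * t + s * t) - φ (n₀ + s * t) - φ (n₀ + s * t) + φ n₀)
  set wt : ℤ → ℤ → ℝ := fun l m =>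
    if l ∈ Icc (1 : ℤ) L ∧ m ∈ Icc (1 : ℤ) M then ψ ((d + s * l) * (w + t * m)) else 0 with hwt
  have hwt_supp : ∀ l m, wt l m ≠ 0 → ν ((d + s * l) * (w + t * m) - n₀) < ρ := by
    intro l m h
    have hval : wt l m = if l ∈ Icc (1 : ℤ) L ∧ m ∈ Icc (1 : ℤ) M
        then ψ ((d + s * l) * (w + t * m)) else 0 := rfl
    by_cases hlm : l ∈ Icc (1 : ℤ) L ∧ m ∈ Icc (1 : ℤ) M
    · rw [hval, if_pos hlm] at h
      exact hsupp _ h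
    · rw [hval, if_neg hlm] at h
      exact absurd rfl h
  have h16eq := sixteen_sum_eq ν hν0 hνnn hνneg hνadd φ hφ (by linarith : 13 * ρ ≤ 100 * ρ)
    d w s t hL hM hst l₀ m₀ wt hwt_supp
    (fun l m => (AddCircle.toCircle (φ ((d + s * l) * (w + t * m))) : ℂ)) (fun l m => rfl)
    (fun l m => ((((if l ∈ Icc (1 : ℤ) L ∧ m ∈ Icc (1 : ℤ) M then ψ ((d + s * l) * (w + t * m))
      else 0 : ℝ)) : ℂ) * (AddCircle.toCircle (φ ((d + s * l) * (w + t * m))) : ℂ)))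
    (fun l m => rfl) θ hθ
  refine ⟨d, w, l₀, m₀, θ, wt, fun l m => rfl, hθ, ?_⟩
  rw [← h16eq]
  exact h16

end Summit.Parity.GeneralizedHardyLittlewood.GreenTaoLevelTwoMNTwoTypeIILargeSixteen
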